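/-
Copyright: the b2b-balaban T⁴-continuum CRUX team, row NE7b leaf-prover lineage `t4-ne7b-formalise-leaf-06` (gen 148). Project licence.
-/
import Mathlib.MeasureTheory.Measure.Haar.InnerProductSpace
import Mathlib.MeasureTheory.Integral.Bochner.Set
import Mathlib.MeasureTheory.Integral.Prod
import Mathlib.Analysis.SpecialFunctions.Exponential
import Mathlib.Analysis.Convex.Topology
import Mathlib.Analysis.Convex.Strong
import Mathlib.Topology.Algebra.Module.Equiv

/-!
# JOINT CONVEX WINDOWS ENTER THE MARGINAL STEP ON THE OPEN BASE WINDOW `π₁(int K)` — the integrability and positivity letters of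
# `…LogConcaveMarginal` §3 discharged for a bounded convex window and a continuous exponent (row NE7b, node U5c)

Cell `pub-balaban`, sub-cell `t4`, spine estimate NE7b (`T4WeightBudget.RelWeightBound`; the cell's OWN estimate — NOT PRINTED in [Bałaban 1983–89],
NOT PROVED).  Crux-route work under `Spine/NE7b/` by a LEAF of the row (FREEZE (0) crux-prover clause); NOTHING of Bałaban's is named or asserted;
no `T4Continuum/Support` leaf typed; no `def`; zero `sorry`.  Mathlib only.

WHY.  `…LogConcaveMarginal.strongConvexOn_neg_log_fibreIntegral` turns the joint letter «`V` is `λ`-convex in the base direction ON the convex window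
`K ⊆ ℝᵐ × ℝⁿ`» into `StrongConvexOn B λ (x ↦ −log ∫_{K_x} e^{−V(x,·)})` on any convex base set `B` over which it is HANDED two letters: the fibre
densities `e^{−V(x,·)}` are integrable on the fibres `K_x = Prod.mk x ⁻¹' K` (`hint`) and have positive integral (`hpos`).  For PRODUCT windows `B ×ˢ F`
`…FibreWindowSmooth` discharges both from `volume F ≠ 0`; for a JOINT window — fibres that MOVE with the base point, the generality (26) §3 is written
in and the case `…StrongConvexSubgradientField` (leaf-03) addresses — nothing in the tree says where the fibres have mass.  This file: for `K` convex and
bounded and `V` continuous, `hint` holds at EVERY base point and `hpos` holds EXACTLY where it can, on the projection of the interior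
`B = Prod.fst '' interior K`, which is OPEN and CONVEX — so (26) §3 applies on `B` with no displayed letter left but the convexity of `V`, and `B` is
the open convex window on which a field ∕ subgradient currency re-enters.

WHAT IS PROVED ([folklore]): §1 fibres of bounded ∕ open sets (`isBounded_fibre`, `isOpen_fibre`), the base window `Prod.fst '' interior K` is convex
(`convex_fst_image_interior`) and open (`isOpen_fst_image_interior`), and over it every fibre has POSITIVE VOLUME (`measure_fibre_pos_of_mem`: the fibre of
an interior point contains an open set; any `IsOpenPosMeasure`); §2 for `V` continuous on `ℝᵐ × ℝⁿ` and `K` bounded and measurable: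
**`integrableOn_fibre_exp_neg`** (`hint`, every `x`), **`fibreIntegral_exp_neg_pos`** (`hpos` on `Prod.fst '' interior K`), both in (26) §3's literal
binder shapes; `fibreIntegral_exp_neg_nonneg` everywhere; §3 PRODUCT windows read through a split chart `S : G ≃L[ℝ] X × Y` (chair leaf-05 g147's located
ο-leaf05-g147-1): `fibre_prodWindow_of_mem` (over `x ∈ B` the (26)-fibre of `S.symm ⁻¹' (S ⁻¹' (B ×ˢ F))` IS `F`; `∅` off `B`), `strongConvexOn_congr` (the
`StrongConvexOn` twin of Mathlib's `ConvexOn.congr`) and **`strongConvexOn_marginal_prodWindow_iff`** — the (26)-currency marginal and the `F`-currency marginal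
(`V⁺` of `…EuclideanCarrierSplit` §5 ∕ `…FibreWindowSmooth`) are the SAME `StrongConvexOn B m` statement.  §4 toy (the unit ball of `ℝᵐ × ℝⁿ`).
§5 THE INHERITABLE CURRENCY (chair leaf-05 g148's OFFER ο-leaf05-g148-1, bytes adopted verbatim): `hint` ∕ `hpos` from «`V` MEASURABLE with `c ≤ V` ON `K`»
(`integrableOn_fibre_exp_neg_of_le`, `fibreIntegral_exp_neg_pos_of_le`, `marginal_letters_on_fst_image_interior_of_le`) — the letters a JOINT-window step
REPRODUCES (a continuous `V` does not survive: `V⁺ → +∞` at `∂B`): `measurable_fibreIntegral_exp_neg` ∕ `measurable_neg_log_fibreIntegral` (Fubini–Tonelli),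
`fibreIntegral_exp_neg_le`, `exists_le_neg_log_fibreIntegral` (`c − log vol B̄(0,R) ≤ V⁺` on `B`), `isBounded_fst_image_interior`, `measurableSet_fst_image_interior`,
**`tower_letters`** (the quadruple «window bounded ∕ measurable; exponent measurable ∕ bounded below on the window» is handed from `(K, V)` to `(B, V⁺)`;
convexity of `V⁺` ON `B` is (26) §3's conclusion), `exists_le_on_of_continuous` (§2's currency ⟹ §5's).
NOT HERE (honest): the convexity letter itself; unbounded windows (then `hint` is a genuine decay letter); which of print's windows are joint in which
chart ((A3)∕(A1c), NC-NE7b-α UNRULED); anything of Bałaban's.  BY-NAME EFFECT ON THE WALL: NONE.  NE7b NOT PRINTED ∕ NOT PROVED; spine PROVED 0∕9;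
rung (B)+1 on a FINITE torus — NOT infinite volume, NOT the mass gap, NOT Clay.
HONEST DEPENDENCY: continuum YM on T⁴ ⇐ BetaPertH ∧ nine spine estimates (0/9 proved); BetaPertH ⇐ (D1) ∧ (D4) ∧ CAP+tail. -/

set_option autoImplicit false

noncomputable section

open MeasureTheory Real Set Bornology

namespace Summit.QuantumFields.BalabanUV.T4Continuum.NE7b.ConvexWindowFibres

/-! ## §1 Fibres and the base window `Prod.fst '' interior K` -/

section Fibres

variable {X Y : Type*}

/-- Fibres of a bounded set are bounded. [folklore] -/
theorem isBounded_fibre [PseudoMetricSpace X] [PseudoMetricSpace Y] {K : Set (X × Y)} (hK : IsBounded K) (x : X) :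
    IsBounded (Prod.mk x ⁻¹' K) :=
  (LipschitzWith.prod_snd.isBounded_image hK).subset fun y hy => ⟨(x, y), hy, rfl⟩

/-- Fibres of an open set are open. [folklore] -/
theorem isOpen_fibre [TopologicalSpace X] [TopologicalSpace Y] {U : Set (X × Y)} (hU : IsOpen U) (x : X) : IsOpen (Prod.mk x ⁻¹' U) :=
  hU.preimage (Continuous.prodMk_right x)

/-- The base window `Prod.fst '' interior K` of a convex window is convex. [folklore] -/
theorem convex_fst_image_interior [NormedAddCommGroup X] [NormedSpace ℝ X] [NormedAddCommGroup Y] [NormedSpace ℝ Y] {K : Set (X × Y)}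
    (hK : Convex ℝ K) : Convex ℝ (Prod.fst '' interior K) :=
  hK.interior.linear_image (LinearMap.fst ℝ X Y)

/-- The base window `Prod.fst '' interior K` is open (the projection is an open map). [folklore] -/
theorem isOpen_fst_image_interior [TopologicalSpace X] [TopologicalSpace Y] (K : Set (X × Y)) : IsOpen (Prod.fst '' interior K) :=
  isOpenMap_fst _ isOpen_interior

/-- It lies inside the projection of the window. [folklore] -/
theorem fst_image_interior_subset [TopologicalSpace X] [TopologicalSpace Y] (K : Set (X × Y)) : Prod.fst '' interior K ⊆ Prod.fst '' K :=
  image_mono interior_subset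

/-- **OVER THE BASE WINDOW EVERY FIBRE HAS POSITIVE VOLUME**: if `x = p.1` for an interior point `p` of `K`, the fibre `K_x` contains the open,
non-empty fibre of `interior K` through `p.2`, hence has positive measure for any measure positive on open sets. [folklore] -/
theorem measure_fibre_pos_of_mem [TopologicalSpace X] [TopologicalSpace Y] [MeasurableSpace Y] (μ : Measure Y) [μ.IsOpenPosMeasure]
    {K : Set (X × Y)} {x : X} (hx : x ∈ Prod.fst '' interior K) : 0 < μ (Prod.mk x ⁻¹' K) := by
  obtain ⟨p, hp, rfl⟩ := hx
  have hsub : Prod.mk p.1 ⁻¹' interior K ⊆ Prod.mk p.1 ⁻¹' K := preimage_mono interior_subset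
  exact lt_of_lt_of_le ((isOpen_fibre isOpen_interior p.1).measure_pos μ ⟨p.2, hp⟩) (measure_mono hsub)

end Fibres

/-! ## §2 The letters `hint` ∕ `hpos` of `…LogConcaveMarginal` §3 for a bounded window and a continuous exponent -/

section Letters

variable {m n : ℕ}

/-- **`hint` AT EVERY BASE POINT**: `V` continuous, `K` bounded ⟹ `e^{−V(x,·)}` is integrable on every fibre `K_x` (continuity on the compact closure
of the bounded fibre). [folklore] -/
theorem integrableOn_fibre_exp_neg {V : EuclideanSpace ℝ (Fin m) × EuclideanSpace ℝ (Fin n) → ℝ} (hVc : Continuous V)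
    {K : Set (EuclideanSpace ℝ (Fin m) × EuclideanSpace ℝ (Fin n))} (hKb : IsBounded K) (x : EuclideanSpace ℝ (Fin m)) :
    IntegrableOn (fun y => exp (-V (x, y))) (Prod.mk x ⁻¹' K) := by
  have hc : ContinuousOn (fun y => exp (-V (x, y))) (closure (Prod.mk x ⁻¹' K)) :=
    (continuous_exp.comp ((hVc.comp (Continuous.prodMk_right x)).neg)).continuousOn
  exact (hc.integrableOn_compact (isBounded_fibre hKb x).isCompact_closure).mono_set subset_closure

/-- The fibre integral is non-negative everywhere. [folklore] -/
theorem fibreIntegral_exp_neg_nonneg (V : EuclideanSpace ℝ (Fin m) × EuclideanSpace ℝ (Fin n) → ℝ)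
    (K : Set (EuclideanSpace ℝ (Fin m) × EuclideanSpace ℝ (Fin n))) (x : EuclideanSpace ℝ (Fin m)) :
    0 ≤ ∫ y in Prod.mk x ⁻¹' K, exp (-V (x, y)) :=
  integral_nonneg fun _ => (exp_pos _).le

/-- **`hpos` ON THE BASE WINDOW**: `V` continuous, `K` bounded ⟹ `0 < ∫_{K_x} e^{−V(x,·)}` for every `x ∈ Prod.fst '' interior K`. [folklore] -/
theorem fibreIntegral_exp_neg_pos {V : EuclideanSpace ℝ (Fin m) × EuclideanSpace ℝ (Fin n) → ℝ} (hVc : Continuous V)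
    {K : Set (EuclideanSpace ℝ (Fin m) × EuclideanSpace ℝ (Fin n))} (hKb : IsBounded K) {x : EuclideanSpace ℝ (Fin m)}
    (hx : x ∈ Prod.fst '' interior K) : 0 < ∫ y in Prod.mk x ⁻¹' K, exp (-V (x, y)) := by
  haveI : NeZero (volume.restrict (Prod.mk x ⁻¹' K) : Measure (EuclideanSpace ℝ (Fin n))) :=
    ⟨fun h => (measure_fibre_pos_of_mem volume hx).ne' (Measure.restrict_eq_zero.1 h)⟩
  exact integral_exp_pos (integrableOn_fibre_exp_neg hVc hKb x)

/-- **BOTH LETTERS IN `…LogConcaveMarginal` §3's BINDER SHAPES on `B = Prod.fst '' interior K`** (with `convex_fst_image_interior` for `hB`):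
`hint : ∀ x ∈ B, IntegrableOn (fun y => exp (-V (x, y))) (Prod.mk x ⁻¹' K)` and `hpos : ∀ x ∈ B, 0 < ∫ y in Prod.mk x ⁻¹' K, exp (-V (x, y))`.
[folklore] -/
theorem marginal_letters_on_fst_image_interior {V : EuclideanSpace ℝ (Fin m) × EuclideanSpace ℝ (Fin n) → ℝ} (hVc : Continuous V)
    {K : Set (EuclideanSpace ℝ (Fin m) × EuclideanSpace ℝ (Fin n))} (hKb : IsBounded K) :
    (∀ x ∈ Prod.fst '' interior K, IntegrableOn (fun y => exp (-V (x, y))) (Prod.mk x ⁻¹' K)) ∧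
      ∀ x ∈ Prod.fst '' interior K, 0 < ∫ y in Prod.mk x ⁻¹' K, exp (-V (x, y)) :=
  ⟨fun x _ => integrableOn_fibre_exp_neg hVc hKb x, fun _ hx => fibreIntegral_exp_neg_pos hVc hKb hx⟩

/-- When the window has an interior point, the base window is non-empty (so (26) §3 on it is not vacuous). [folklore] -/
theorem fst_image_interior_nonempty {K : Set (EuclideanSpace ℝ (Fin m) × EuclideanSpace ℝ (Fin n))} (hK : (interior K).Nonempty) :
    (Prod.fst '' interior K).Nonempty :=
  hK.image _

/-- For a convex window with non-empty interior the base window misses nothing but boundary: `Prod.fst '' K ⊆ closure (Prod.fst '' interior K)`.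
[folklore] -/
theorem fst_image_subset_closure_fst_image_interior {K : Set (EuclideanSpace ℝ (Fin m) × EuclideanSpace ℝ (Fin n))} (hKc : Convex ℝ K)
    (hK : (interior K).Nonempty) : Prod.fst '' K ⊆ closure (Prod.fst '' interior K) := by
  calc Prod.fst '' K ⊆ Prod.fst '' closure K := image_mono subset_closure
    _ = Prod.fst '' closure (interior K) := by rw [hKc.closure_interior_eq_closure_of_nonempty_interior hK]
    _ ⊆ closure (Prod.fst '' interior K) := image_closure_subset_closure_image continuous_fst

end Letters

/-! ## §3 Product windows read through a split chart: the two fibre currencies meet on the base window -/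

section ProductWindows

variable {E : Type*} [NormedAddCommGroup E] [NormedSpace ℝ E]

/-- `StrongConvexOn` only sees the values on the window: functions that agree ON `s` are interchangeable (Mathlib has `ConvexOn.congr`; this is the
uniform ∕ strong twin). [folklore] -/
theorem uniformConvexOn_congr {s : Set E} {φ : ℝ → ℝ} {f g : E → ℝ} (hf : UniformConvexOn s φ f) (hfg : EqOn f g s) : UniformConvexOn s φ g := by
  refine ⟨hf.1, fun x hx y hy a b ha hb hab => ?_⟩
  rw [← hfg hx, ← hfg hy, ← hfg (hf.1 hx hy ha hb hab)]
  exact hf.2 hx hy ha hb hab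

/-- The `StrongConvexOn` form of `uniformConvexOn_congr`. [folklore] -/
theorem strongConvexOn_congr {s : Set E} {m : ℝ} {f g : E → ℝ} (hf : StrongConvexOn s m f) (hfg : EqOn f g s) : StrongConvexOn s m g :=
  uniformConvexOn_congr hf hfg

variable {G X Y : Type*} [NormedAddCommGroup G] [NormedSpace ℝ G] [NormedAddCommGroup X] [NormedSpace ℝ X] [NormedAddCommGroup Y] [NormedSpace ℝ Y]

/-- **ON THE BASE WINDOW THE (26)-FIBRE OF A PRODUCT WINDOW READ THROUGH A SPLIT CHART IS THE FLUCTUATION WINDOW**: for `S : G ≃L[ℝ] X × Y`, the carrier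
window `S ⁻¹' (B ×ˢ F)` has product image `S.symm ⁻¹' (S ⁻¹' (B ×ˢ F)) = B ×ˢ F`, whose fibre over `x ∈ B` is `F` (and `∅` off `B`). [folklore] -/
theorem fibre_prodWindow_of_mem (S : G ≃L[ℝ] X × Y) {B : Set X} (F : Set Y) {x : X} (hx : x ∈ B) :
    Prod.mk x ⁻¹' (S.symm ⁻¹' (S ⁻¹' (B ×ˢ F))) = F := by
  rw [S.symm_preimage_preimage]; exact mk_preimage_prod_right hx

/-- A bounded CARRIER window has a bounded product window: `IsBounded K → IsBounded (S.symm ⁻¹' K)` (`S.symm ⁻¹' K = S '' K` and `S` is Lipschitz) — so §2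
applies to `S.symm ⁻¹' K` when the socket's window `K ⊆ G` is bounded (chair leaf-05 g147's JG3 glue). [folklore] -/
theorem isBounded_preimage_symm (S : G ≃L[ℝ] X × Y) {K : Set G} (hK : IsBounded K) : IsBounded (S.symm ⁻¹' K) := by
  rw [← S.image_eq_preimage_symm]; exact S.lipschitz.isBounded_image hK

/-- Off the base window the fibre is empty. [folklore] -/
theorem fibre_prodWindow_of_not_mem (S : G ≃L[ℝ] X × Y) {B : Set X} (F : Set Y) {x : X} (hx : x ∉ B) :
    Prod.mk x ⁻¹' (S.symm ⁻¹' (S ⁻¹' (B ×ˢ F))) = ∅ := by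
  rw [S.symm_preimage_preimage]; exact mk_preimage_prod_right_eq_empty hx

/-- **THE TWO MARGINAL EXPONENTS AGREE ON `B`**: with any fibre integrand `Φ`, the (26)-currency marginal `x ↦ −log ∫_{(S.symm ⁻¹' (S ⁻¹'(B ×ˢ F)))_x} Φ x`
and the `F`-currency marginal `x ↦ −log ∫_F Φ x` (the `V⁺` of `…EuclideanCarrierSplit` §5 ∕ `…FibreWindowSmooth`) coincide on `B`; hence `StrongConvexOn B m` of
one is `StrongConvexOn B m` of the other. [folklore] -/
theorem strongConvexOn_marginal_prodWindow_iff [MeasurableSpace Y] (μ : Measure Y) (S : G ≃L[ℝ] X × Y) (B : Set X) (F : Set Y) (m : ℝ)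
    (Φ : X → Y → ℝ) :
    StrongConvexOn B m (fun x => -log (∫ y in Prod.mk x ⁻¹' (S.symm ⁻¹' (S ⁻¹' (B ×ˢ F))), Φ x y ∂μ)) ↔
      StrongConvexOn B m (fun x => -log (∫ y in F, Φ x y ∂μ)) := by
  have h : EqOn (fun x => -log (∫ y in Prod.mk x ⁻¹' (S.symm ⁻¹' (S ⁻¹' (B ×ˢ F))), Φ x y ∂μ)) (fun x => -log (∫ y in F, Φ x y ∂μ)) B :=
    fun x hx => by simp only [fibre_prodWindow_of_mem S F hx]
  exact ⟨fun hc => strongConvexOn_congr hc h, fun hc => strongConvexOn_congr hc h.symm⟩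

end ProductWindows

/-! ## §4 Non-vacuity -/

/-- Toy: the open unit ball of `ℝᵐ × ℝⁿ` is a bounded convex window with non-empty interior; with `V = 0` both letters hold on its base window. -/
example (m n : ℕ) :
    (∀ x ∈ Prod.fst '' interior (Metric.ball (0 : EuclideanSpace ℝ (Fin m) × EuclideanSpace ℝ (Fin n)) 1),
        IntegrableOn (fun y => exp (-(fun _ : EuclideanSpace ℝ (Fin m) × EuclideanSpace ℝ (Fin n) => (0 : ℝ)) (x, y)))
          (Prod.mk x ⁻¹' Metric.ball (0 : EuclideanSpace ℝ (Fin m) × EuclideanSpace ℝ (Fin n)) 1)) ∧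
      ∀ x ∈ Prod.fst '' interior (Metric.ball (0 : EuclideanSpace ℝ (Fin m) × EuclideanSpace ℝ (Fin n)) 1),
        0 < ∫ y in Prod.mk x ⁻¹' Metric.ball (0 : EuclideanSpace ℝ (Fin m) × EuclideanSpace ℝ (Fin n)) 1,
          exp (-(fun _ : EuclideanSpace ℝ (Fin m) × EuclideanSpace ℝ (Fin n) => (0 : ℝ)) (x, y)) :=
  marginal_letters_on_fst_image_interior continuous_const Metric.isBounded_ball

/-! ## §5 (OFFER ο-leaf05-g148-1, chair leaf-05 g148): the INHERITABLE currency — `hint` ∕ `hpos` from «`V` measurable and bounded below ON `K`»,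
and the letters the marginal `V⁺(x) = −log ∫_{K_x} e^{−V(x,·)}` hands to the NEXT joint-window step

WHY.  §2 reads `hint` ∕ `hpos` from `Continuous V` (on the whole space).  Across a JOINT-window step that letter is not reproduced: the
marginal `V⁺` is finite only on the base window `Prod.fst '' interior K` and tends to `+∞` at its boundary whenever the fibre volumes
`vol K_x` tend to `0` (unit disc, `V ≡ c`: `V⁺(x) = c − log (2√(1−x²)) → +∞` as `|x| → 1`), so no continuous extension of `V⁺` to the base space exists and §2 cannot be
re-applied to `V⁺` at the next splitting.  What IS reproduced is the weaker pair «`V` measurable, `c ≤ V` on `K`» together with «`K` bounded,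
measurable»: it gives `hint` at every base point and `hpos` on `Prod.fst '' interior K` (this §), and the marginal inherits it —
`x ↦ ∫_{K_x} e^{−V(x,·)}` is measurable, and on the base window `c − log vol(B̄_R) ≤ V⁺` where `K ⊆ B̄_R` (this §); the base window itself is
bounded, open (hence measurable) and convex (§1).  With (26) §3 supplying the convexity of `V⁺` ON the base window, the quadruple
(window bounded ∕ convex ∕ measurable; exponent measurable ∕ bounded below on the window) is closed under the marginal step. [folklore] -/

section Tower

variable {m n : ℕ}

/-- **`hint` FROM MEASURABILITY AND A LOWER BOUND ON THE WINDOW**: `K` bounded and measurable, `V` measurable with `c ≤ V` on `K` ⟹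
`e^{−V(x,·)}` is integrable on every fibre `K_x` (bounded integrand `≤ e^{−c}` on a set of finite volume). [folklore] -/
theorem integrableOn_fibre_exp_neg_of_le {V : EuclideanSpace ℝ (Fin m) × EuclideanSpace ℝ (Fin n) → ℝ} (hVm : Measurable V)
    {K : Set (EuclideanSpace ℝ (Fin m) × EuclideanSpace ℝ (Fin n))} (hKb : IsBounded K) (hKm : MeasurableSet K) {c : ℝ}
    (hc : ∀ p ∈ K, c ≤ V p) (x : EuclideanSpace ℝ (Fin m)) :
    IntegrableOn (fun y => exp (-V (x, y))) (Prod.mk x ⁻¹' K) := by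
  refine IntegrableOn.of_bound (isBounded_fibre hKb x).measure_lt_top
    ((hVm.comp measurable_prodMk_left).neg.exp.aestronglyMeasurable) (exp (-c)) ?_
  refine ae_restrict_of_forall_mem (measurable_prodMk_left hKm) fun y hy => ?_
  rw [Real.norm_eq_abs, abs_of_pos (exp_pos _)]
  exact exp_le_exp.2 (neg_le_neg (hc (x, y) hy))

/-- **`hpos` ON THE BASE WINDOW, same currency**: `0 < ∫_{K_x} e^{−V(x,·)}` for every `x ∈ Prod.fst '' interior K`. [folklore] -/
theorem fibreIntegral_exp_neg_pos_of_le {V : EuclideanSpace ℝ (Fin m) × EuclideanSpace ℝ (Fin n) → ℝ} (hVm : Measurable V)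
    {K : Set (EuclideanSpace ℝ (Fin m) × EuclideanSpace ℝ (Fin n))} (hKb : IsBounded K) (hKm : MeasurableSet K) {c : ℝ}
    (hc : ∀ p ∈ K, c ≤ V p) {x : EuclideanSpace ℝ (Fin m)} (hx : x ∈ Prod.fst '' interior K) :
    0 < ∫ y in Prod.mk x ⁻¹' K, exp (-V (x, y)) := by
  haveI : NeZero (volume.restrict (Prod.mk x ⁻¹' K) : Measure (EuclideanSpace ℝ (Fin n))) :=
    ⟨fun h => (measure_fibre_pos_of_mem volume hx).ne' (Measure.restrict_eq_zero.1 h)⟩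
  exact integral_exp_pos (integrableOn_fibre_exp_neg_of_le hVm hKb hKm hc x)

/-- Both letters in (26) §3's binder shapes on `B = Prod.fst '' interior K`, inheritable currency. [folklore] -/
theorem marginal_letters_on_fst_image_interior_of_le {V : EuclideanSpace ℝ (Fin m) × EuclideanSpace ℝ (Fin n) → ℝ} (hVm : Measurable V)
    {K : Set (EuclideanSpace ℝ (Fin m) × EuclideanSpace ℝ (Fin n))} (hKb : IsBounded K) (hKm : MeasurableSet K) {c : ℝ}
    (hc : ∀ p ∈ K, c ≤ V p) :
    (∀ x ∈ Prod.fst '' interior K, IntegrableOn (fun y => exp (-V (x, y))) (Prod.mk x ⁻¹' K)) ∧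
      ∀ x ∈ Prod.fst '' interior K, 0 < ∫ y in Prod.mk x ⁻¹' K, exp (-V (x, y)) :=
  ⟨fun x _ => integrableOn_fibre_exp_neg_of_le hVm hKb hKm hc x, fun _ hx => fibreIntegral_exp_neg_pos_of_le hVm hKb hKm hc hx⟩

/-- **THE FIBRE INTEGRAL IS A MEASURABLE FUNCTION OF THE BASE POINT** (joint window; Fubini–Tonelli measurability of the partial integral of
`1_K · e^{−V}`). [folklore] -/
theorem measurable_fibreIntegral_exp_neg {V : EuclideanSpace ℝ (Fin m) × EuclideanSpace ℝ (Fin n) → ℝ} (hVm : Measurable V)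
    {K : Set (EuclideanSpace ℝ (Fin m) × EuclideanSpace ℝ (Fin n))} (hKm : MeasurableSet K) :
    Measurable fun x : EuclideanSpace ℝ (Fin m) => ∫ y in Prod.mk x ⁻¹' K, exp (-V (x, y)) := by
  have hF : StronglyMeasurable (K.indicator fun p : EuclideanSpace ℝ (Fin m) × EuclideanSpace ℝ (Fin n) => exp (-V p)) :=
    (hVm.neg.exp.indicator hKm).stronglyMeasurable
  have h := (hF.integral_prod_right' (ν := (volume : Measure (EuclideanSpace ℝ (Fin n))))).measurable
  have heq : (fun x : EuclideanSpace ℝ (Fin m) => ∫ y in Prod.mk x ⁻¹' K, exp (-V (x, y))) =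
      fun x => ∫ y, K.indicator (fun p : EuclideanSpace ℝ (Fin m) × EuclideanSpace ℝ (Fin n) => exp (-V p)) (x, y) := by
    funext x
    rw [← integral_indicator (measurable_prodMk_left hKm)]
    rfl
  rw [heq]; exact h

/-- Hence the marginal exponent `V⁺ = −log ∫_{K_x} e^{−V(x,·)}` is measurable on the base space. [folklore] -/
theorem measurable_neg_log_fibreIntegral {V : EuclideanSpace ℝ (Fin m) × EuclideanSpace ℝ (Fin n) → ℝ} (hVm : Measurable V)
    {K : Set (EuclideanSpace ℝ (Fin m) × EuclideanSpace ℝ (Fin n))} (hKm : MeasurableSet K) :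
    Measurable fun x : EuclideanSpace ℝ (Fin m) => -log (∫ y in Prod.mk x ⁻¹' K, exp (-V (x, y))) :=
  (measurable_log.comp (measurable_fibreIntegral_exp_neg hVm hKm)).neg

/-- **THE FIBRE INTEGRAL IS BOUNDED ABOVE, uniformly in the base point**: with `K ⊆ B̄(0,R)` (product norm) and `c ≤ V` on `K`,
`∫_{K_x} e^{−V(x,·)} ≤ e^{−c} · vol(B̄(0,R) ⊆ ℝⁿ)` for every `x`. [folklore] -/
theorem fibreIntegral_exp_neg_le {V : EuclideanSpace ℝ (Fin m) × EuclideanSpace ℝ (Fin n) → ℝ}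
    {K : Set (EuclideanSpace ℝ (Fin m) × EuclideanSpace ℝ (Fin n))} {R c : ℝ}
    (hKR : K ⊆ Metric.closedBall 0 R) (hc : ∀ p ∈ K, c ≤ V p) (x : EuclideanSpace ℝ (Fin m)) :
    ∫ y in Prod.mk x ⁻¹' K, exp (-V (x, y)) ≤
      exp (-c) * volume.real (Metric.closedBall (0 : EuclideanSpace ℝ (Fin n)) R) := by
  have hsub : Prod.mk x ⁻¹' K ⊆ Metric.closedBall (0 : EuclideanSpace ℝ (Fin n)) R := fun y hy => by
    have h := hKR hy
    rw [Metric.mem_closedBall, dist_zero_right] at h ⊢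
    exact (norm_snd_le (x, y)).trans h
  have hfin : volume (Prod.mk x ⁻¹' K) < ⊤ :=
    measure_lt_top_of_subset hsub (Metric.isBounded_closedBall.measure_lt_top).ne
  have h1 : ‖∫ y in Prod.mk x ⁻¹' K, exp (-V (x, y))‖ ≤ exp (-c) * volume.real (Prod.mk x ⁻¹' K) :=
    norm_setIntegral_le_of_norm_le_const hfin fun y hy => by
      rw [Real.norm_eq_abs, abs_of_pos (exp_pos _)]
      exact exp_le_exp.2 (neg_le_neg (hc (x, y) hy))
  calc ∫ y in Prod.mk x ⁻¹' K, exp (-V (x, y)) ≤ ‖∫ y in Prod.mk x ⁻¹' K, exp (-V (x, y))‖ := le_norm_self _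
    _ ≤ exp (-c) * volume.real (Prod.mk x ⁻¹' K) := h1
    _ ≤ exp (-c) * volume.real (Metric.closedBall (0 : EuclideanSpace ℝ (Fin n)) R) :=
        mul_le_mul_of_nonneg_left (measureReal_mono hsub (Metric.isBounded_closedBall.measure_lt_top).ne) (exp_pos _).le

/-- **THE LOWER BOUND IS INHERITED BY THE MARGINAL ON THE BASE WINDOW**: `K` bounded and measurable, `V` measurable with `c ≤ V` on `K`
⟹ there is `c'` with `c' ≤ V⁺(x) = −log ∫_{K_x} e^{−V(x,·)}` for every `x ∈ Prod.fst '' interior K` (explicitly `c' = c − log vol B̄(0,R)`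
for any `R` with `K ⊆ B̄(0,R)`). [folklore] -/
theorem exists_le_neg_log_fibreIntegral {V : EuclideanSpace ℝ (Fin m) × EuclideanSpace ℝ (Fin n) → ℝ} (hVm : Measurable V)
    {K : Set (EuclideanSpace ℝ (Fin m) × EuclideanSpace ℝ (Fin n))} (hKb : IsBounded K) (hKm : MeasurableSet K) {c : ℝ}
    (hc : ∀ p ∈ K, c ≤ V p) :
    ∃ c' : ℝ, ∀ x ∈ Prod.fst '' interior K, c' ≤ -log (∫ y in Prod.mk x ⁻¹' K, exp (-V (x, y))) := by
  obtain ⟨R, hKR⟩ := hKb.subset_closedBall 0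
  refine ⟨c - log (volume.real (Metric.closedBall (0 : EuclideanSpace ℝ (Fin n)) R)), fun x hx => ?_⟩
  have hpos := fibreIntegral_exp_neg_pos_of_le hVm hKb hKm hc hx
  have hle := fibreIntegral_exp_neg_le hKR hc x
  have hv : 0 < exp (-c) * volume.real (Metric.closedBall (0 : EuclideanSpace ℝ (Fin n)) R) := hpos.trans_le hle
  have hv' : 0 < volume.real (Metric.closedBall (0 : EuclideanSpace ℝ (Fin n)) R) :=
    pos_of_mul_pos_right hv (exp_pos _).le
  have hlog : log (∫ y in Prod.mk x ⁻¹' K, exp (-V (x, y))) ≤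
      -c + log (volume.real (Metric.closedBall (0 : EuclideanSpace ℝ (Fin n)) R)) := by
    calc log (∫ y in Prod.mk x ⁻¹' K, exp (-V (x, y)))
        ≤ log (exp (-c) * volume.real (Metric.closedBall (0 : EuclideanSpace ℝ (Fin n)) R)) := log_le_log hpos hle
      _ = -c + log (volume.real (Metric.closedBall (0 : EuclideanSpace ℝ (Fin n)) R)) := by
          rw [log_mul (exp_pos _).ne' hv'.ne', log_exp]
  linarith

/-- **THE BASE WINDOW INHERITS THE WINDOW LETTERS**: it is bounded (and, by §1, open and convex; open ⟹ measurable). [folklore] -/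
theorem isBounded_fst_image_interior {K : Set (EuclideanSpace ℝ (Fin m) × EuclideanSpace ℝ (Fin n))} (hKb : IsBounded K) :
    IsBounded (Prod.fst '' interior K) :=
  (LipschitzWith.prod_fst.isBounded_image hKb).subset (image_mono interior_subset)

/-- Measurability of the base window (it is open, §1). [folklore] -/
theorem measurableSet_fst_image_interior (K : Set (EuclideanSpace ℝ (Fin m) × EuclideanSpace ℝ (Fin n))) :
    MeasurableSet (Prod.fst '' interior K) :=
  (isOpen_fst_image_interior K).measurableSet

/-- **TOWER LETTER (one marginal step reproduces the currency)**: from (`K` bounded, measurable; `V` measurable, `c ≤ V` on `K`) the step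
hands over, for the base window `B = Prod.fst '' interior K` and the marginal `V⁺ x = −log ∫_{K_x} e^{−V(x,·)}`: `B` bounded and measurable
(convex and open by §1), `V⁺` measurable, and `∃ c', c' ≤ V⁺` on `B` — i.e. every non-convexity hypothesis this § asks of `(K, V)` holds
again for `(B, V⁺)` read in any product chart of the base space (boundedness ∕ measurability ∕ lower bounds are chart-invariant; §3,
`…EuclideanCarrierSplit`).  The convexity of `V⁺` ON `B` is (26) §3's conclusion. [folklore] -/
theorem tower_letters {V : EuclideanSpace ℝ (Fin m) × EuclideanSpace ℝ (Fin n) → ℝ} (hVm : Measurable V)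
    {K : Set (EuclideanSpace ℝ (Fin m) × EuclideanSpace ℝ (Fin n))} (hKb : IsBounded K) (hKm : MeasurableSet K) {c : ℝ}
    (hc : ∀ p ∈ K, c ≤ V p) :
    IsBounded (Prod.fst '' interior K) ∧ MeasurableSet (Prod.fst '' interior K) ∧
      Measurable (fun x : EuclideanSpace ℝ (Fin m) => -log (∫ y in Prod.mk x ⁻¹' K, exp (-V (x, y)))) ∧
      ∃ c' : ℝ, ∀ x ∈ Prod.fst '' interior K, c' ≤ -log (∫ y in Prod.mk x ⁻¹' K, exp (-V (x, y))) :=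
  ⟨isBounded_fst_image_interior hKb, measurableSet_fst_image_interior K, measurable_neg_log_fibreIntegral hVm hKm,
    exists_le_neg_log_fibreIntegral hVm hKb hKm hc⟩

/-- §2's continuous currency is a special case: `Continuous V` and `K` bounded give `c ≤ V` on `K` (minimum over the compact closure). [folklore] -/
theorem exists_le_on_of_continuous {V : EuclideanSpace ℝ (Fin m) × EuclideanSpace ℝ (Fin n) → ℝ} (hVc : Continuous V)
    {K : Set (EuclideanSpace ℝ (Fin m) × EuclideanSpace ℝ (Fin n))} (hKb : IsBounded K) : ∃ c : ℝ, ∀ p ∈ K, c ≤ V p := by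
  rcases K.eq_empty_or_nonempty with rfl | hne
  · exact ⟨0, fun p hp => hp.elim⟩
  obtain ⟨p₀, -, hp₀⟩ := hKb.isCompact_closure.exists_isMinOn (hne.mono subset_closure) hVc.continuousOn
  exact ⟨V p₀, fun p hp => hp₀ (subset_closure hp)⟩

end Tower

/-! ### §5 non-vacuity -/

/-- Toy for §5: the unit ball of `ℝᵐ × ℝⁿ` with `V = 0` (`c = 0`): all four handed letters hold. -/
example (m n : ℕ) :
    IsBounded (Prod.fst '' interior (Metric.ball (0 : EuclideanSpace ℝ (Fin m) × EuclideanSpace ℝ (Fin n)) 1)) ∧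
      MeasurableSet (Prod.fst '' interior (Metric.ball (0 : EuclideanSpace ℝ (Fin m) × EuclideanSpace ℝ (Fin n)) 1)) ∧
      Measurable (fun x : EuclideanSpace ℝ (Fin m) => -log (∫ y in Prod.mk x ⁻¹' Metric.ball (0 : EuclideanSpace ℝ (Fin m) × EuclideanSpace ℝ (Fin n)) 1,
        exp (-(fun _ : EuclideanSpace ℝ (Fin m) × EuclideanSpace ℝ (Fin n) => (0 : ℝ)) (x, y)))) ∧
      ∃ c' : ℝ, ∀ x ∈ Prod.fst '' interior (Metric.ball (0 : EuclideanSpace ℝ (Fin m) × EuclideanSpace ℝ (Fin n)) 1),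
        c' ≤ -log (∫ y in Prod.mk x ⁻¹' Metric.ball (0 : EuclideanSpace ℝ (Fin m) × EuclideanSpace ℝ (Fin n)) 1,
          exp (-(fun _ : EuclideanSpace ℝ (Fin m) × EuclideanSpace ℝ (Fin n) => (0 : ℝ)) (x, y))) :=
  tower_letters measurable_const Metric.isBounded_ball Metric.isOpen_ball.measurableSet (c := 0) fun _ _ => le_rfl

end Summit.QuantumFields.BalabanUV.T4Continuum.NE7b.ConvexWindowFibres

end
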